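import Summits.CriticalPhenomena.PercolationContinuityZ3.Theorems.SoloBlindKNUniformCoefficients

/-!
# Layer cake: uniform coefficients are EQUIVALENT to Kozma–Nitzan's Conjecture 4 at `(G, A, o)`

Companion to `SoloBlindKNUniformCoefficients.lean` (notation `m_x`, `E_F(x)`, `KNConj4Real`, `KNUniformUpsets`
from there).  That file proves `KNConj4Real w A o → KNUniformUpsets w A o` by LP duality.  Here the converse:
if ONE probability vector `c` on `A` satisfies `∑_a c_a μ(C(a) ∈ 𝒰, o ↔ A) ≤ μ(C(o) ∈ 𝒰, o ↔ A)` for every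
up-set `𝒰` of vertex sets, then `∑_a c_a E_F(a) ≤ E_F(o)` — hence `min_a E_F(a) ≤ E_F(o)` — for every
real-valued increasing `F` (layer-cake decomposition `F - F(∅) = ∑_t δ_t 𝟙_{F ≥ t}` on the finite lattice of
vertex sets, done as an induction on the support, plus the total-mass identity
`∑_S (m_o(S) - ∑_a c_a m_a(S)) = μ(o ↔ A)(1 - ∑_a c_a) = 0`).  So **Conjecture 4 of [KozmaNitzan2024] at a
given `(G, A, o)` is exactly the linear feasibility problem `KNUniformUpsets`** (`knConj4Real_iff_uniformUpsets`):
`|A|` unknowns, one linear constraint per up-set of vertex sets.  New; finite graphs, arbitrary weights; no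
sorry, no new axioms.  [cite: KozmaNitzan2024, Conjecture 4 (p. 32)]
-/

noncomputable section

open MeasureTheory Set Finset
open scoped BigOperators
open Literature.Probability.LatticeModels (prodBernoulli)
open Literature.Probability.Percolation

namespace Summit.CriticalPhenomena.PercolationContinuityZ3.Theorems.SoloBlindKN

section Percolation

variable {V : Type*} [Fintype V]

/-! ### The converse: uniform coefficients give Conjecture 4 for every real-valued monotone property

(layer-cake on the finite lattice of vertex sets), so that Conjecture 4 at `(G, A, o)` is literally EQUIVALENT to
the linear feasibility statement `KNUniformUpsets`. -/

/-- **Layer-cake positivity.** If a signed weight `ν` on vertex sets is nonnegative on every up-set, then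
`∑_S G(S) ν(S) ≥ 0` for every nonnegative monotone `G` (induction on the support of `G`: peel off
`t·𝟙_{G > 0}` with `t` the least positive value). [folklore] -/
theorem sum_mul_nonneg_of_upsets (ν : Set V → ℝ)
    (hν : ∀ 𝒰 : Set (Set V), IsUpperSet 𝒰 → 0 ≤ ∑ S, setInd 𝒰 S * ν S) :
    ∀ (n : ℕ) (G : Set V → ℝ), (Finset.univ.filter fun S => G S ≠ 0).card ≤ n →
      (∀ S, 0 ≤ G S) → Monotone G → 0 ≤ ∑ S, G S * ν S := by
  classical
  intro n
  induction n with
  | zero =>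
    intro G hcard hG0 _
    have hz : ∀ S, G S = 0 := by
      intro S
      by_contra h
      have hmem : S ∈ Finset.univ.filter (fun S => G S ≠ 0) := by simp [h]
      rw [Nat.le_zero, Finset.card_eq_zero] at hcard
      rw [hcard] at hmem
      simp at hmem
    simp [hz]
  | succ n ih =>
    intro G hcard hG0 hG
    by_cases hz : ∀ S, G S = 0
    · simp [hz]
    push Not at hz
    set P := Finset.univ.filter (fun S : Set V => G S ≠ 0) with hP
    have hPne : P.Nonempty := by
      obtain ⟨S, hS⟩ := hz
      exact ⟨S, by simp [hP, hS]⟩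
    obtain ⟨S₀, hS₀P, hS₀⟩ := Finset.exists_mem_eq_inf' hPne G
    set t := P.inf' hPne G with ht
    have hGS₀ : G S₀ ≠ 0 := (Finset.mem_filter.1 hS₀P).2
    have htpos : 0 < t := by
      rw [hS₀]; exact lt_of_le_of_ne (hG0 S₀) hGS₀.symm
    let 𝒰 : Set (Set V) := {S | G S ≠ 0}
    have hmem𝒰 : ∀ S, S ∈ 𝒰 ↔ G S ≠ 0 := fun S => Iff.rfl
    have h𝒰 : IsUpperSet 𝒰 := by
      intro S T hST hS
      rw [hmem𝒰] at hS ⊢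
      have : 0 < G S := lt_of_le_of_ne (hG0 S) (Ne.symm hS)
      exact ne_of_gt (this.trans_le (hG hST))
    have hGt : ∀ S, S ∈ 𝒰 → t ≤ G S := fun S hS =>
      Finset.inf'_le G (by simp [hP, (hmem𝒰 S).1 hS])
    let G' : Set V → ℝ := fun S => G S - t * setInd 𝒰 S
    have hG'𝒰 : ∀ S, S ∈ 𝒰 → G' S = G S - t := fun S hS => by
      simp only [G', setInd_apply, if_pos hS, mul_one]
    have hG'n : ∀ S, S ∉ 𝒰 → G' S = 0 := fun S hS => by
      have h0 : G S = 0 := by rw [hmem𝒰] at hS; push Not at hS; exact hS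
      simp only [G', setInd_apply, if_neg hS, mul_zero, sub_zero, h0]
    have hG'0 : ∀ S, 0 ≤ G' S := by
      intro S
      by_cases hS : S ∈ 𝒰
      · rw [hG'𝒰 S hS]; linarith [hGt S hS]
      · rw [hG'n S hS]
    have hG'mono : Monotone G' := by
      intro S T hST
      by_cases hS : S ∈ 𝒰
      · rw [hG'𝒰 S hS, hG'𝒰 T (h𝒰 hST hS)]; linarith [hG hST]
      · rw [hG'n S hS]; exact hG'0 T
    have hcard' : (Finset.univ.filter fun S => G' S ≠ 0).card ≤ n := by
      have hsub : (Finset.univ.filter fun S => G' S ≠ 0) ⊆ P.erase S₀ := by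
        intro S hS
        rw [Finset.mem_filter] at hS
        rw [Finset.mem_erase]
        have hS𝒰 : S ∈ 𝒰 := by
          by_contra hn; exact hS.2 (hG'n S hn)
        refine ⟨?_, by simp [hP, (hmem𝒰 S).1 hS𝒰]⟩
        rintro rfl
        apply hS.2
        rw [hG'𝒰 S hS𝒰, ← hS₀, ht]; ring
      have h1 := Finset.card_le_card hsub
      rw [Finset.card_erase_of_mem hS₀P] at h1
      have h2 : P.card ≤ n + 1 := hcard
      omega
    have ih' := ih G' hcard' hG'0 hG'mono
    have hsplit : ∑ S, G S * ν S = t * ∑ S, setInd 𝒰 S * ν S + ∑ S, G' S * ν S := by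
      rw [Finset.mul_sum, ← Finset.sum_add_distrib]
      refine Finset.sum_congr rfl fun S _ => ?_
      simp only [G']; ring
    rw [hsplit]
    have h3 := hν 𝒰 h𝒰
    positivity

/-- **Uniform coefficients give Conjecture 4 at `(G, A, o)` for every real-valued monotone cluster
property** (layer cake + total mass `∑_S ν(S) = μ(o ↔ A)(1 - ∑ c_a) = 0`). (New.) -/
theorem knConj4Real_of_uniformUpsets (w : Sym2 V → unitInterval) (A : Finset V) (o : V)
    (h : KNUniformUpsets w A o) : KNConj4Real w A o := by
  classical
  obtain ⟨c, hc0, hc1, hc⟩ := h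
  intro F hF
  apply exists_le_of_convexComb_le hc0 hc1
  let ν : Set V → ℝ := fun S => clusterPM w A o o S - ∑ a ∈ A, c a * clusterPM w A o a S
  have hlin : ∀ G : Set V → ℝ,
      ∑ S, G S * ν S = clusterExp w A o G o - ∑ a ∈ A, c a * clusterExp w A o G a := by
    intro G
    simp only [ν, clusterExp, mul_sub, Finset.sum_sub_distrib, Finset.mul_sum]
    congr 1
    rw [Finset.sum_comm]
    exact Finset.sum_congr rfl fun a _ => Finset.sum_congr rfl fun S _ => by ring
  have hν : ∀ 𝒰 : Set (Set V), IsUpperSet 𝒰 → 0 ≤ ∑ S, setInd 𝒰 S * ν S := by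
    intro 𝒰 h𝒰; rw [hlin]; linarith [hc 𝒰 h𝒰]
  have hmass : ∑ S, ν S = 0 := by
    have h1 := hlin (setInd (Set.univ : Set (Set V)))
    have e : ∀ x, clusterExp w A o (setInd (Set.univ : Set (Set V))) x = (prodBernoulli w).real (connTo o A) := by
      intro x
      rw [clusterExp_setInd]
      congr 1
      ext ω
      simp
    simp only [e] at h1
    rw [← Finset.sum_mul, hc1, one_mul, sub_self] at h1
    have h2 : ∑ S, ν S = ∑ S, setInd (Set.univ : Set (Set V)) S * ν S :=
      Finset.sum_congr rfl fun S _ => by rw [setInd_apply]; simp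
    rw [h2, h1]
  let G : Set V → ℝ := fun S => F S - F ∅
  have hG0 : ∀ S, 0 ≤ G S := fun S => sub_nonneg.2 (hF (Set.empty_subset S))
  have hGm : Monotone G := fun S T hST => sub_le_sub_right (hF hST) _
  have key := sum_mul_nonneg_of_upsets ν hν _ G le_rfl hG0 hGm
  have hGF : ∑ S, G S * ν S = ∑ S, F S * ν S := by
    simp only [G, sub_mul, Finset.sum_sub_distrib, ← Finset.mul_sum, hmass, mul_zero, sub_zero]
  rw [hGF, hlin] at key
  linarith

/-- **Kozma–Nitzan's Conjecture 4 at `(G, A, o)` is equivalent to the existence of uniform coefficients**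
(a linear feasibility problem in `|A|` unknowns with one constraint per up-set of vertex sets). (New.) -/
theorem knConj4Real_iff_uniformUpsets (w : Sym2 V → unitInterval) (A : Finset V) (o : V) :
    KNConj4Real w A o ↔ KNUniformUpsets w A o :=
  ⟨knUniformUpsets_of_conj4Real w A o, knConj4Real_of_uniformUpsets w A o⟩

end Percolation

end Summit.CriticalPhenomena.PercolationContinuityZ3.Theorems.SoloBlindKN

end
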